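import Mathlib

/-!
# Stub `stub_cardCyclesLE` (B2c) of crux `stmt-ValiantsHypothesis-6283`

Crux: `Summit.ValiantsHypothesis.ValiantsHypothesis.Theses.TwistedDetRank.FermionicNormalForm`,
line `registered` (`Cruxes/FermionicNormalForm/Lines/birth.lean`), stub `stub_cardCyclesLE`.

The symmetric group `S_n = Equiv.Perm (Fin n)` has at most `n ^ j` cycles of length `j`
(a `j`-cycle is typed decidably as `γ.cycleType = {j}`).

Proof: by Mathlib's exact count `Equiv.Perm.card_of_cycleType_singleton`, for `2 ≤ j ≤ n`
the number of such permutations is `(j-1)! * choose n j ≤ j! * choose n j = n.descFactorial j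
≤ n ^ j` (`Nat.descFactorial_eq_factorial_mul_choose`, `Nat.descFactorial_le_pow`);
otherwise it is `0` (`Equiv.Perm.card_of_cycleType_eq_zero_iff`).
-/

-- single-conjunct layout: Sub = Summit, duplicated namespace component intended
set_option linter.dupNamespace false

namespace Summit.ValiantsHypothesis.ValiantsHypothesis.Theorems.TwistedDetRankFermionicNormalForm

/-- `S_n` has at most `n ^ j` cycles of length `j`: the number of permutations of `Fin n`
whose cycle type is the singleton `{j}` is at most `n ^ j`. -/
theorem stub_cardCyclesLE :
    ∀ (n j : ℕ),
      (Finset.univ.filter fun γ : Equiv.Perm (Fin n) => γ.cycleType = {j}).card ≤ n ^ j := by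
  intro n j
  by_cases h : j ≤ n ∧ 2 ≤ j
  · obtain ⟨hjn, hj⟩ := h
    have key := Equiv.Perm.card_of_cycleType_singleton (α := Fin n) (n := j) hj
      (by rw [Fintype.card_fin]; exact hjn)
    rw [Fintype.card_fin] at key
    rw [key]
    calc (j - 1).factorial * n.choose j ≤ j.factorial * n.choose j :=
          Nat.mul_le_mul_right _ (Nat.factorial_le (Nat.sub_le j 1))
      _ = n.descFactorial j := (Nat.descFactorial_eq_factorial_mul_choose n j).symm
      _ ≤ n ^ j := Nat.descFactorial_le_pow n j
  · have key := (Equiv.Perm.card_of_cycleType_eq_zero_iff (Fin n) (m := {j})).mpr (by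
      rw [Multiset.sum_singleton, Fintype.card_fin]
      rintro ⟨hjn, hj⟩
      exact h ⟨hjn, hj j (Multiset.mem_singleton_self j)⟩)
    rw [key]
    exact Nat.zero_le _

end Summit.ValiantsHypothesis.ValiantsHypothesis.Theorems.TwistedDetRankFermionicNormalForm
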